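import Literature.Probability.RandomPlanarGeometry.BrownianLoopMassChain
import HarnessLib

/-!
# Brownian loop masses: the core estimate for large loops, `O((log t)^{-9/8})`

Proof file (theorems only). With the bridge `b_s = Z_s − s • Z_1` of `BrownianLoopMeasure`, the
large-duration part of the loop mass `Λ(K₁, K₂; D)` (for `K₁ ⊆ B̄(0, R)` and `D` missing the disc
`B(z₀, r)`) is controlled, after Brownian scaling by `√t`, by

  `G(t) = E |{w : (∃ s ≤ 1, w + b_s ∈ B̄(0, R/√t)) ∧ ∀ s ≤ 1, w + b_s ∉ B(z₀/√t, r/√t)}|`.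

* `lintegral_volume_bridge_hit_avoid_le_log_rpow` — **there are `T₀ > 1` and `C` with
  `G(t) ≤ C (log t)^{-9/8}` for all `t ≥ T₀`.**

This is `lintegral_volume_bridge_hit_avoid_le` (`BrownianLoopMassChain`) with the parameters
`M = (log t)^{1/8}`, `ρ = M⁻⁴`, `s₀ = M⁻¹`, `λ = Λ = M`: the two logarithms of the argument
(`1/log` for coming `1/√t`-close to a point from distance `≍ 1` within unit time, through the
expected sausage area, and `1/log` for then escaping without touching the `1/√t`-disc) give
`(log t)⁻¹ · (log t)^{-1/8}`, the loss `(log t)^{7/8}` against the optimal `(log t)⁻²` coming from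
the crude sausage bound; any exponent `> 1` suffices for the finiteness of `Λ`
(`∫^∞ (log t)^{-9/8} dt/t < ∞`). No definition and no named fact is introduced.

## References

* G. F. Lawler, *Partition functions, loop measure, and versions of SLE*, J. Stat. Phys. 134 (2009),
  §2.2. [Lawler2009]
-/

noncomputable section

open MeasureTheory ProbabilityTheory Filter Set Metric Complex
open scoped NNReal ENNReal Topology

namespace Literature.Probability.RandomPlanarGeometry

open Literature.Probability.Process
open BrownianLoop (planarBrownian)

/-! ### Real-analysis preliminaries -/

/-- `e^{x} ≥ x²/4` for `x ≥ 0` (from `1 + y ≤ e^y` at `y = x/2`). [folklore] -/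
theorem sq_div_four_le_exp {x : ℝ} (hx : 0 ≤ x) : x ^ 2 / 4 ≤ Real.exp x := by
  have h1 : 1 + x / 2 ≤ Real.exp (x / 2) := by linarith [Real.add_one_le_exp (x / 2)]
  have h2 : Real.exp x = Real.exp (x / 2) ^ 2 := by rw [← Real.exp_nat_mul]; ring_nf
  rw [h2]
  have h3 : 0 ≤ 1 + x / 2 := by linarith
  nlinarith [pow_le_pow_left₀ h3 h1 2]

/-- `log L ≤ 2 √L` for `L > 0`. [folklore] -/
theorem log_le_two_mul_sqrt {L : ℝ} (hL : 0 < L) : Real.log L ≤ 2 * Real.sqrt L := by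
  have h1 : Real.log (Real.sqrt L) ≤ Real.sqrt L - 1 := Real.log_le_sub_one_of_pos (Real.sqrt_pos.2 hL)
  have h2 : Real.log L = 2 * Real.log (Real.sqrt L) := by
    rw [Real.log_sqrt hL.le]; ring
  rw [h2]; linarith

/-- The eighth root `M = L^{1/8}` satisfies `M⁸ = L` (`L ≥ 0`). [folklore] -/
theorem rpow_one_div_eight_pow_eight {L : ℝ} (hL : 0 ≤ L) : (L ^ ((1 : ℝ) / 8)) ^ 8 = L := by
  rw [← Real.rpow_natCast, ← Real.rpow_mul hL]; norm_num

/-- `L^{-9/8} = (M⁹)⁻¹` with `M = L^{1/8}` (`L ≥ 0`). [folklore] -/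
theorem rpow_neg_nine_div_eight {L : ℝ} (hL : 0 ≤ L) : L ^ (-(9 : ℝ) / 8) = ((L ^ ((1 : ℝ) / 8)) ^ 9)⁻¹ := by
  rw [← Real.rpow_natCast, ← Real.rpow_mul hL, ← Real.rpow_neg hL]; norm_num

/-- `M = L^{1/8} ≥ 9` when `L ≥ 9⁸`. [folklore] -/
theorem nine_le_rpow_one_div_eight {L : ℝ} (hL : (9 : ℝ) ^ 8 ≤ L) : 9 ≤ L ^ ((1 : ℝ) / 8) := by
  have h0 : (0 : ℝ) ≤ 9 ^ 8 := by positivity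
  calc (9 : ℝ) = ((9 : ℝ) ^ 8) ^ ((1 : ℝ) / 8) := by
        rw [← Real.rpow_natCast, ← Real.rpow_mul (by norm_num)]; norm_num
    _ ≤ L ^ ((1 : ℝ) / 8) := Real.rpow_le_rpow h0 hL (by norm_num)

/-! ### The core estimate -/

set_option maxHeartbeats 1600000 in
-- the final assembly of explicit constants is long but elementary
/-- **The core estimate for large loops.** For `R ≥ 0`, `r > 0` and `z₀ ∈ ℂ` there are `T₀ > 1` and
`C ≥ 0` such that for all `t ≥ T₀`,

  `E |{w : (∃ s ≤ 1, w + b_s ∈ B̄(0, R/√t)) ∧ ∀ s ≤ 1, w + b_s ∉ B(z₀/√t, r/√t)}| ≤ C (log t)^{-9/8}`,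

`b_s = Z_s − s • Z_1` the planar Brownian bridge. [cite: Lawler2009, §2.2 (finiteness of Λ(K₁,K₂;D), stated)] -/
theorem lintegral_volume_bridge_hit_avoid_le_log_rpow {R r : ℝ} (hR : 0 ≤ R) (hr : 0 < r) (z₀ : ℂ) :
    ∃ T₀ : ℝ, 1 < T₀ ∧ ∃ C : ℝ, 0 ≤ C ∧ ∀ t : ℝ, T₀ ≤ t →
      ∫⁻ ω, volume {w : ℂ | (∃ s : ℝ≥0, s ≤ 1 ∧
          w + (planarBrownian s ω - (s : ℝ) • planarBrownian 1 ω) ∈ closedBall 0 ((Real.sqrt t)⁻¹ * R)) ∧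
          ∀ s : ℝ≥0, s ≤ 1 → w + (planarBrownian s ω - (s : ℝ) • planarBrownian 1 ω) ∉
            ball ((Real.sqrt t)⁻¹ • z₀) ((Real.sqrt t)⁻¹ * r)} ∂wienerPair ≤
        ENNReal.ofReal (C * Real.log t ^ (-(9 : ℝ) / 8)) := by
  -- constants
  set R₃ : ℝ := R + ‖z₀‖ + r with hR₃def
  have hR₃ : 0 < R₃ := by rw [hR₃def]; linarith [norm_nonneg z₀]
  have hR₃r : r ≤ R₃ := by rw [hR₃def]; linarith [norm_nonneg z₀]
  set ℓ₀ : ℝ := Real.log (2 * R₃ / r) with hℓ₀def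
  have hℓ₀ : 0 < ℓ₀ := Real.log_pos (by rw [lt_div_iff₀ hr]; linarith)
  set J : ℝ≥0∞ := ∫⁻ w, ENNReal.ofReal ((1 + ‖w‖) ^ (-(3 : ℝ))) ∂(volume : Measure ℂ) with hJ
  have hJtop : J ≠ ∞ := lintegral_one_add_norm_rpow_neg_three_lt_top.ne
  set Jr : ℝ := J.toReal with hJr
  have hJr : 0 ≤ Jr := ENNReal.toReal_nonneg
  have hJeq : J = ENNReal.ofReal Jr := (ENNReal.ofReal_toReal hJtop).symm
  set CS : ℝ := Real.pi + 4 * Real.pi + 2 ^ 10 * Real.pi + 2 ^ 17 * Jr with hCSdef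
  have hCS : 0 ≤ CS := by positivity
  set C : ℝ := 2 * 19 * (4 * ℓ₀ + 2) * CS with hC
  have hC0 : 0 ≤ C := by positivity
  -- the threshold
  set L₀ : ℝ := max ((9 : ℝ) ^ 8) (max (16 * R₃ + 1) (max r (max (16 * (1 + |Real.log (r / 2)|) ^ 2)
    (4 * |Real.log R₃| + 1)))) with hL₀
  have hL₀9 : (9 : ℝ) ^ 8 ≤ L₀ := le_max_left _ _
  have hL₀R : 16 * R₃ + 1 ≤ L₀ := le_trans (le_max_left _ _) (le_max_right _ _)
  have hL₀r : r ≤ L₀ := le_trans (le_trans (le_max_left _ _) (le_max_right _ _)) (le_max_right _ _)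
  have hL₀l : 16 * (1 + |Real.log (r / 2)|) ^ 2 ≤ L₀ :=
    le_trans (le_trans (le_trans (le_max_left _ _) (le_max_right _ _)) (le_max_right _ _)) (le_max_right _ _)
  have hL₀3 : 4 * |Real.log R₃| + 1 ≤ L₀ :=
    le_trans (le_trans (le_trans (le_max_right _ _) (le_max_right _ _)) (le_max_right _ _)) (le_max_right _ _)
  have hL₀pos : 0 < L₀ := lt_of_lt_of_le (by positivity) hL₀9
  refine ⟨Real.exp L₀, by rw [← Real.exp_zero]; exact Real.exp_lt_exp.2 hL₀pos, C, hC0, fun t ht ↦ ?_⟩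
  -- the scale
  have ht0 : 0 < t := (Real.exp_pos L₀).trans_le ht
  set L : ℝ := Real.log t with hLdef
  have hLL₀ : L₀ ≤ L := by rw [hLdef, ← Real.log_exp L₀]; exact Real.log_le_log (Real.exp_pos _) ht
  have hL9 : (9 : ℝ) ^ 8 ≤ L := hL₀9.trans hLL₀
  have hL1 : 1 ≤ L := le_trans (by norm_num) hL9
  have hL0 : 0 < L := by linarith
  set M : ℝ := L ^ ((1 : ℝ) / 8) with hMdef
  have hM9 : 9 ≤ M := nine_le_rpow_one_div_eight hL9
  have hM1 : 1 ≤ M := by linarith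
  have hM0 : 0 < M := by linarith
  have hM8 : M ^ 8 = L := rpow_one_div_eight_pow_eight hL0.le
  have hML : M ≤ L := by
    calc M = M ^ 1 := (pow_one M).symm
      _ ≤ M ^ 8 := pow_le_pow_right₀ hM1 (by norm_num)
      _ = L := hM8
  have hM4 : M ^ 4 ≤ L := by
    calc M ^ 4 ≤ M ^ 8 := pow_le_pow_right₀ hM1 (by norm_num)
      _ = L := hM8
  set ε : ℝ := (Real.sqrt t)⁻¹ with hεdef
  have hsqrt : Real.sqrt t = Real.exp (L / 2) := by
    rw [hLdef, show L / 2 = Real.log t * (1 / 2) by ring, Real.exp_mul, Real.exp_log ht0, Real.sqrt_eq_rpow]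
  have hε0 : 0 < ε := by rw [hεdef]; exact inv_pos.2 (Real.sqrt_pos.2 ht0)
  have hexpL : L ^ 2 / 16 ≤ Real.exp (L / 2) := by
    have := sq_div_four_le_exp (by linarith : 0 ≤ L / 2)
    calc L ^ 2 / 16 = (L / 2) ^ 2 / 4 := by ring
      _ ≤ Real.exp (L / 2) := this
  -- `ε R₃ L ≤ 1/16`-type smallness: `R₃ L < e^{L/2}`
  have hR₃L : R₃ * L < Real.exp (L / 2) := by
    have h1 : 16 * R₃ < L := by linarith [hL₀R.trans hLL₀]
    calc R₃ * L < (L / 16) * L := by apply mul_lt_mul_of_pos_right _ hL0; linarith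
      _ = L ^ 2 / 16 := by ring
      _ ≤ Real.exp (L / 2) := hexpL
  set a : ℝ := ε * R₃ with hadef
  have ha0 : 0 < a := mul_pos hε0 hR₃
  have haM : a * M < 1 := by
    have key : R₃ * M < Real.exp (L / 2) :=
      lt_of_le_of_lt (mul_le_mul_of_nonneg_left hML hR₃.le) hR₃L
    rw [hadef, hεdef, hsqrt]
    calc (Real.exp (L / 2))⁻¹ * R₃ * M = (R₃ * M) / Real.exp (L / 2) := by ring
      _ < 1 := (div_lt_one (Real.exp_pos _)).2 key
  have haM4 : a * M ^ 4 < 1 := by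
    have key : R₃ * M ^ 4 < Real.exp (L / 2) :=
      lt_of_le_of_lt (mul_le_mul_of_nonneg_left hM4 hR₃.le) hR₃L
    rw [hadef, hεdef, hsqrt]
    calc (Real.exp (L / 2))⁻¹ * R₃ * M ^ 4 = (R₃ * M ^ 4) / Real.exp (L / 2) := by ring
      _ < 1 := (div_lt_one (Real.exp_pos _)).2 key
  have ha1 : a ≤ 1 := by
    have : a * 1 ≤ a * M := mul_le_mul_of_nonneg_left hM1 ha0.le
    linarith
  have hεr8 : ε * r ≤ 8 := by
    have h1 : ε * r ≤ a := mul_le_mul_of_nonneg_left hR₃r hε0.le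
    linarith
  -- parameters of the chain
  set ρ : ℝ := (M ^ 4)⁻¹ with hρdef
  have hρ0 : 0 < ρ := by positivity
  have haρ : a < ρ := by
    rw [hρdef, lt_inv_comm₀ ha0 (by positivity)]
    calc M ^ 4 = (a * M ^ 4) / a := by field_simp
      _ < 1 / a := div_lt_div_of_pos_right haM4 ha0
      _ = a⁻¹ := one_div a
  set s₀ : ℝ := M⁻¹ with hs₀def
  have has : a ≤ s₀ := by
    rw [hs₀def, le_inv_comm₀ ha0 hM0]
    calc M = (a * M) / a := by field_simp
      _ ≤ 1 / a := div_le_div_of_nonneg_right haM.le ha0.le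
      _ = a⁻¹ := one_div a
  have hal : a < M := lt_of_le_of_lt ha1 (by linarith)
  have hl8 : 8 ≤ M := by linarith
  have hΛ8 : a + 8 ≤ M := by linarith
  have hΛa : 2 * a ≤ M := by linarith
  -- the identification of the chain's `a`
  have hnormc : ‖ε • z₀‖ = ε * ‖z₀‖ := by rw [norm_smul, Real.norm_eq_abs, abs_of_pos hε0]
  have haeq : ε * R + ‖ε • z₀‖ + ε * r = a := by rw [hnormc, hadef, hR₃def]; ring
  -- apply the chain
  have hchain := lintegral_volume_bridge_hit_avoid_le (c := ε • z₀) (R' := ε * R) (r' := ε * r) (ρ := ρ) (s₀ := s₀)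
    (lam := M) (Λ := M) (mul_nonneg hε0.le hR) (mul_pos hε0 hr) hεr8 (by rw [haeq]; exact haρ)
    (by rw [haeq]; exact has) (by rw [haeq]; exact hal) hl8 (by rw [haeq]; exact hΛ8) (by rw [haeq]; exact hΛa) hM1
  rw [haeq] at hchain
  refine hchain.trans ?_
  ----------------------------------------------------------------
  -- bounding the constants
  ----------------------------------------------------------------
  set η : ℝ := ε * r / 8 with hηdef
  have hη0 : 0 < η := by positivity
  -- `K₁ K₂ ≤ 19`
  have hquarter : ((1 - 3 / 4 : ℝ≥0) : ℝ) = 1 / 4 := by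
    rw [NNReal.coe_sub (by rw [← NNReal.coe_le_coe]; push_cast; norm_num)]
    push_cast; norm_num
  have hK12 : 7 / η ^ 2 * (2 * η * (Real.sqrt (2 * Real.pi * ((1 - 3 / 4 : ℝ≥0) : ℝ)))⁻¹) ^ 2 ≤ 19 := by
    rw [hquarter]
    have hpi : 0 < Real.pi := Real.pi_pos
    have hs : Real.sqrt (2 * Real.pi * (1 / 4)) ^ 2 = Real.pi / 2 := by
      rw [Real.sq_sqrt (by positivity)]; ring
    have hsq : (2 * η * (Real.sqrt (2 * Real.pi * (1 / 4)))⁻¹) ^ 2 = 4 * η ^ 2 / (Real.pi / 2) := by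
      rw [mul_pow, inv_pow, hs]; ring
    rw [hsq]
    have : 7 / η ^ 2 * (4 * η ^ 2 / (Real.pi / 2)) = 56 / Real.pi := by
      field_simp
      ring
    rw [this, div_le_iff₀ hpi]
    linarith [Real.pi_gt_three]
  -- `K₃ ≤ (4ℓ₀ + 2)/L`
  have hfour : ((4⁻¹ : ℝ≥0) : ℝ) = 4⁻¹ := by push_cast; ring
  have hlogρ : L / 4 ≤ Real.log (ρ / (ε * r / 2)) := by
    have h1 : Real.log (ρ / (ε * r / 2)) = Real.log ρ - Real.log ε - Real.log (r / 2) := by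
      rw [Real.log_div hρ0.ne' (by positivity), show ε * r / 2 = ε * (r / 2) by ring,
        Real.log_mul hε0.ne' (by positivity)]
      ring
    have h2 : Real.log ρ = -4 * Real.log M := by
      rw [hρdef, Real.log_inv, Real.log_pow]; push_cast; ring
    have h3 : Real.log ε = -(L / 2) := by
      rw [hεdef, Real.log_inv, hsqrt, Real.log_exp]
    have h4 : Real.log M = (1 / 8) * Real.log L := by
      rw [hMdef, Real.log_rpow hL0]
    have h5 : Real.log L ≤ 2 * Real.sqrt L := log_le_two_mul_sqrt hL0
    have h6 : 4 * (1 + |Real.log (r / 2)|) ≤ Real.sqrt L := by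
      rw [show 4 * (1 + |Real.log (r / 2)|) = Real.sqrt ((4 * (1 + |Real.log (r / 2)|)) ^ 2) by
        rw [Real.sqrt_sq (by positivity)]]
      refine Real.sqrt_le_sqrt ?_
      calc (4 * (1 + |Real.log (r / 2)|)) ^ 2 = 16 * (1 + |Real.log (r / 2)|) ^ 2 := by ring
        _ ≤ L := hL₀l.trans hLL₀
    have h7 : Real.sqrt L * Real.sqrt L = L := Real.mul_self_sqrt hL0.le
    have h8 : 1 ≤ Real.sqrt L := by rw [← Real.sqrt_one]; exact Real.sqrt_le_sqrt hL1
    have k1 : 4 * (1 + |Real.log (r / 2)|) * Real.sqrt L ≤ L := by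
      have := mul_le_mul_of_nonneg_right h6 (Real.sqrt_nonneg L); rwa [h7] at this
    have k2 : |Real.log (r / 2)| ≤ |Real.log (r / 2)| * Real.sqrt L := le_mul_of_one_le_right (abs_nonneg _) h8
    have k3 : Real.log (r / 2) ≤ |Real.log (r / 2)| := le_abs_self _
    rw [h1, h2, h3, h4]
    linarith
  have hK3 : Real.log (a / (ε * r / 2)) / Real.log (ρ / (ε * r / 2)) + ρ ^ 2 / (2 * ((4⁻¹ : ℝ≥0) : ℝ)) ≤
      (4 * ℓ₀ + 2) / L := by
    rw [hfour]
    have h1 : Real.log (a / (ε * r / 2)) = ℓ₀ := by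
      rw [hℓ₀def, hadef]; congr 1; field_simp
    have h2 : ρ ^ 2 / (2 * (4⁻¹ : ℝ)) = 2 / L := by
      rw [hρdef, ← hM8]; field_simp; ring
    rw [h1, h2]
    have hden : 0 < Real.log (ρ / (ε * r / 2)) := lt_of_lt_of_le (by linarith) hlogρ
    have h3 : ℓ₀ / Real.log (ρ / (ε * r / 2)) ≤ ℓ₀ / (L / 4) := div_le_div_of_nonneg_left hℓ₀.le (by linarith) hlogρ
    rw [show (4 * ℓ₀ + 2) / L = ℓ₀ / (L / 4) + 2 / L by field_simp]
    linarith
  -- the sausage constant `≤ CS / M`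
  have hhalf : ((2⁻¹ : ℝ≥0) : ℝ) = 1 / 2 := by push_cast; ring
  have hloga : L / 4 ≤ Real.log (M / a) := by
    have h1 : Real.log (M / a) = Real.log M - Real.log ε - Real.log R₃ := by
      rw [Real.log_div hM0.ne' ha0.ne', hadef, Real.log_mul hε0.ne' hR₃.ne']; ring
    have h2 : Real.log M = (1 / 8) * Real.log L := by rw [hMdef, Real.log_rpow hL0]
    have h3 : Real.log ε = -(L / 2) := by rw [hεdef, Real.log_inv, hsqrt, Real.log_exp]
    have h4 : 0 ≤ Real.log L := Real.log_nonneg hL1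
    have h5 : Real.log R₃ ≤ |Real.log R₃| := le_abs_self _
    have h6 := hL₀3.trans hLL₀
    rw [h1, h2, h3]
    linarith
  have hS1 : M / s₀ / Real.log (M / a) ≤ 4 / M ^ 6 := by
    rw [hs₀def, div_inv_eq_mul]
    have hden : 0 < Real.log (M / a) := lt_of_lt_of_le (by linarith) hloga
    calc M * M / Real.log (M / a) ≤ M * M / (L / 4) := div_le_div_of_nonneg_left (by positivity) (by linarith) hloga
      _ = 4 / M ^ 6 := by rw [← hM8]; field_simp
  have hS2 : 2 ^ 12 * ((2⁻¹ : ℝ≥0) : ℝ) ^ 2 / M ^ 4 = 2 ^ 10 / M ^ 4 := by rw [hhalf]; ring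
  have hS3 : 2 ^ 19 * ((2⁻¹ : ℝ≥0) : ℝ) ^ 2 / M = 2 ^ 17 / M := by rw [hhalf]; ring
  -- convert every factor to `ofReal` of a real and multiply
  have hpiE : (NNReal.pi : ℝ≥0∞) = ENNReal.ofReal Real.pi := by
    rw [← ENNReal.ofReal_coe_nnreal, NNReal.coe_real_pi]
  have e1 : ENNReal.ofReal (7 / η ^ 2) * ENNReal.ofReal ((2 * η * (Real.sqrt (2 * Real.pi * ((1 - 3 / 4 : ℝ≥0) : ℝ)))⁻¹) ^ 2)
      ≤ ENNReal.ofReal 19 := by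
    rw [← ENNReal.ofReal_mul (by positivity)]
    exact ENNReal.ofReal_le_ofReal hK12
  have e2 : ENNReal.ofReal (Real.log (a / (ε * r / 2)) / Real.log (ρ / (ε * r / 2)) + ρ ^ 2 / (2 * ((4⁻¹ : ℝ≥0) : ℝ)))
      ≤ ENNReal.ofReal ((4 * ℓ₀ + 2) / L) := ENNReal.ofReal_le_ofReal hK3
  have hMM2 : M ≤ M ^ 2 := le_self_pow₀ hM1 (by norm_num)
  have hMM4 : M ≤ M ^ 4 := le_self_pow₀ hM1 (by norm_num)
  have hq3 : Real.pi / M ^ 2 ≤ Real.pi / M := div_le_div_of_nonneg_left Real.pi_pos.le hM0 hMM2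
  have hq4 : 4 * Real.pi / M ^ 4 ≤ 4 * Real.pi / M := div_le_div_of_nonneg_left (by positivity) hM0 hMM4
  have hq5 : 2 ^ 10 * Real.pi / M ^ 2 ≤ 2 ^ 10 * Real.pi / M :=
    div_le_div_of_nonneg_left (by positivity) hM0 hMM2
  have eA₁ : ENNReal.ofReal s₀ ^ 2 * NNReal.pi ≤ ENNReal.ofReal (Real.pi / M) := by
    rw [hpiE, ← ENNReal.ofReal_pow (by positivity), ← ENNReal.ofReal_mul (by positivity)]
    refine ENNReal.ofReal_le_ofReal ?_
    calc s₀ ^ 2 * Real.pi = Real.pi / M ^ 2 := by rw [hs₀def]; field_simp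
      _ ≤ Real.pi / M := hq3
  have eA₂ : ENNReal.ofReal M ^ 2 * NNReal.pi *
      (ENNReal.ofReal (M / s₀ / Real.log (M / a)) + ENNReal.ofReal (2 ^ 10 / M ^ 4)) ≤
      ENNReal.ofReal ((4 * Real.pi + 2 ^ 10 * Real.pi) / M) := by
    calc ENNReal.ofReal M ^ 2 * NNReal.pi * (ENNReal.ofReal (M / s₀ / Real.log (M / a)) + ENNReal.ofReal (2 ^ 10 / M ^ 4))
        ≤ ENNReal.ofReal M ^ 2 * NNReal.pi * (ENNReal.ofReal (4 / M ^ 6) + ENNReal.ofReal (2 ^ 10 / M ^ 4)) := by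
          gcongr
      _ = ENNReal.ofReal (M ^ 2 * Real.pi * (4 / M ^ 6 + 2 ^ 10 / M ^ 4)) := by
          rw [hpiE, ← ENNReal.ofReal_pow hM0.le, ← ENNReal.ofReal_mul (by positivity),
            ← ENNReal.ofReal_add (by positivity) (by positivity), ← ENNReal.ofReal_mul (by positivity)]
      _ ≤ ENNReal.ofReal ((4 * Real.pi + 2 ^ 10 * Real.pi) / M) := by
          refine ENNReal.ofReal_le_ofReal ?_
          have : M ^ 2 * Real.pi * (4 / M ^ 6 + 2 ^ 10 / M ^ 4) = 4 * Real.pi / M ^ 4 + 2 ^ 10 * Real.pi / M ^ 2 := by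
            field_simp
          rw [this]
          calc 4 * Real.pi / M ^ 4 + 2 ^ 10 * Real.pi / M ^ 2 ≤ 4 * Real.pi / M + 2 ^ 10 * Real.pi / M := add_le_add hq4 hq5
            _ = (4 * Real.pi + 2 ^ 10 * Real.pi) / M := by ring
  have eA₃ : ENNReal.ofReal (2 ^ 17 / M) * J = ENNReal.ofReal (2 ^ 17 * Jr / M) := by
    rw [hJeq, ← ENNReal.ofReal_mul (by positivity)]
    congr 1; ring
  have e3 : ENNReal.ofReal s₀ ^ 2 * NNReal.pi +
      ENNReal.ofReal M ^ 2 * NNReal.pi * (ENNReal.ofReal (M / s₀ / Real.log (M / a)) +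
        ENNReal.ofReal (2 ^ 12 * ((2⁻¹ : ℝ≥0) : ℝ) ^ 2 / M ^ 4)) +
      ENNReal.ofReal (2 ^ 19 * ((2⁻¹ : ℝ≥0) : ℝ) ^ 2 / M) * J ≤ ENNReal.ofReal (CS / M) := by
    rw [hS2, hS3, eA₃]
    calc ENNReal.ofReal s₀ ^ 2 * NNReal.pi +
          ENNReal.ofReal M ^ 2 * NNReal.pi * (ENNReal.ofReal (M / s₀ / Real.log (M / a)) + ENNReal.ofReal (2 ^ 10 / M ^ 4)) +
          ENNReal.ofReal (2 ^ 17 * Jr / M)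
        ≤ ENNReal.ofReal (Real.pi / M) + ENNReal.ofReal ((4 * Real.pi + 2 ^ 10 * Real.pi) / M) +
            ENNReal.ofReal (2 ^ 17 * Jr / M) := by gcongr
      _ = ENNReal.ofReal (CS / M) := by
          rw [← ENNReal.ofReal_add (by positivity) (by positivity), ← ENNReal.ofReal_add (by positivity) (by positivity)]
          congr 1
          rw [hCSdef]
          field_simp
          ring
  calc 2 * (ENNReal.ofReal (7 / η ^ 2) *
        ENNReal.ofReal ((2 * η * (Real.sqrt (2 * Real.pi * ((1 - 3 / 4 : ℝ≥0) : ℝ)))⁻¹) ^ 2) *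
        ENNReal.ofReal (Real.log (a / (ε * r / 2)) / Real.log (ρ / (ε * r / 2)) + ρ ^ 2 / (2 * ((4⁻¹ : ℝ≥0) : ℝ))) *
        (ENNReal.ofReal s₀ ^ 2 * NNReal.pi +
          ENNReal.ofReal M ^ 2 * NNReal.pi * (ENNReal.ofReal (M / s₀ / Real.log (M / a)) +
            ENNReal.ofReal (2 ^ 12 * ((2⁻¹ : ℝ≥0) : ℝ) ^ 2 / M ^ 4)) +
          ENNReal.ofReal (2 ^ 19 * ((2⁻¹ : ℝ≥0) : ℝ) ^ 2 / M) * J))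
      ≤ 2 * (ENNReal.ofReal 19 * ENNReal.ofReal ((4 * ℓ₀ + 2) / L) * ENNReal.ofReal (CS / M)) := by
        gcongr 2 * (?_ * ?_ * ?_)
    _ = ENNReal.ofReal (C * Real.log t ^ (-(9 : ℝ) / 8)) := by
        rw [← ENNReal.ofReal_ofNat 2, ← ENNReal.ofReal_mul (by norm_num), ← ENNReal.ofReal_mul (by positivity),
          ← ENNReal.ofReal_mul (by norm_num)]
        congr 1
        rw [← hLdef, rpow_neg_nine_div_eight hL0.le, ← hMdef, hC]
        have hM9' : M ^ 9 = L * M := by rw [← hM8]; ring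
        rw [hM9']
        field_simp

end Literature.Probability.RandomPlanarGeometry

end
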